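import Literature.AlgebraicGeometry.AbelianSchemes.AbelianSchemeKOfLUnramified
import Literature.AlgebraicGeometry.AbelianSchemes.AbelianSchemeOverMulNEtale
import HarnessLib

/-!
# A finite unramified closed subgroup subscheme of an abelian scheme is killed by an integer and lies in the torsion `A[n]`

Layer `Literature/AlgebraicGeometry/AbelianSchemes`, namespace `Literature.AlgebraicGeometry.AbelianSchemes.AbelianSchemeOver`
(one generic lemma on sections of unramified `S`-schemes in `Literature.AlgebraicGeometry.AbelianSchemes`).  THEOREMS ONLY
(no definition, no named fact, no instance, no notation, no `sorry`).  Cell `hodgecm-mathlib` (D-0151), F-3 sub-line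
`Cruxes/HDel/Lines/F3DualAbelianScheme` stub (K) `stub_F3K` («`K(L)` is finite ÉTALE over a Noetherian affine `ℚ`-base»),
road T of the census `B-provers/B-p03/g20/F3K/CENSUS-F3K-TorsionRoad.B-p03g20.md` (275587c6), bricks **(T3)** and **(T4)**
(author B-p08 (g15)).  HC_CM is proved only modulo the 7 printed citations until rung 0 closes; nothing here is about HC.

SETTING.  `R` a ring, `A` an abelian scheme over `Spec R` (★ `AbelianSchemeOver`), `i : Z ↪ A` a closed immersion over
`Spec R` with `Z → Spec R` finite, through which the unit, the product of the two projections and the inverse factor (the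
shape in which ★ `AbelianSchemeKOfLClosedSubscheme` / ★ `AbelianSchemeKOfLSeesaw.exists_one_mul_inv_fac_of_memKOfL` present
`K(L)`; ★ `AbelianSchemeKOfLUnramified` makes such a `Z` formally unramified over a `ℚ`-algebra).

* §1 `isOpenImmersion_left_of_section` — a SECTION of a formally unramified `S`-scheme locally of finite type is an OPEN
  IMMERSION (the diagonal of an unramified morphism is an open immersion, Mathlib `isOpenImmersion_diagonal`, and a section is
  a base change of the diagonal, Mathlib `MorphismProperty.hasOfPostcompProperty_iff_le_diagonal`); [GortzWedhorn2023]
  Prop. 27.13-style «the unit section of an unramified group scheme is open».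
* §2 `exists_hom_comp_eq_pow` — the powers `i ^ m` (Mathlib's `Hom.group` of the group object `A.X` of `Over (Spec R)`)
  factor through `Z`; `pullback_map_eq_of_comp_eq_pow_order` — on the fibre at a field-valued point `t` the factorisation of
  `i ^ n`, `n` the ORDER of the finite subgroup scheme `Z_t ⊆ A_t` (★ `finiteSubgroupSubschemeFibre`), is the unit (DELIGNE: a
  finite group scheme over a field is killed by its order, ★ `FiniteSubgroupSubscheme.emb_pow_order`, [GortzWedhorn2023]
  Prop. 27.86).
* §3 **`exists_pow_eq_one_of_formallyUnramified`** — **(T3)**: if `Z → Spec R` is formally unramified, `i ^ n = 1` for some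
  `n ≥ 1`.  PROOF: the unit `e : Spec R → Z` is an open immersion (§1); for `m ≥ 1` the preimage `W_m ⊆ Z` of its image under
  the factorisation `v_m` of `i ^ m` is open, and every point `z` lies in `W_{n(z)}`, `n(z)` the order of the fibre through `z`
  (§2) — so finitely many `W_m` cover the quasi-compact `Z` (finite over an affine), `W_n = Z` for `n` the product of their
  indices, `v_n` factors through the open immersion `e` (Mathlib `IsOpenImmersion.lift`), i.e. `v_n = (Z → Spec R) ≫ e` and
  `i ^ n = v_n ≫ i = 1`.  [MumfordAV1970] §13 (p. 123) has `K(L) ⊆ X[n]` over a field from §6 Appl. 3; over a base the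
  statement is the same once the fibres are killed uniformly.
* §4 **(T4)** `left_comp_pow_id_left_eq` / `isClosedImmersion_pullbackLift_unit_pow_id` / `pullbackLift_unit_pow_id_fst` /
  `pullbackLift_unit_pow_id_snd` — given `i ^ n = 1`, `Z` is a CLOSED subscheme of the `n`-torsion
  `A[n] = Spec R ×_{e, A, [n]} A` (`j := pullback.lift (Z → Spec R) i`, a closed immersion since `i` is one and `A[n] → A` is
  separated), which is FINITE ÉTALE over `Spec R` when `n` is invertible on the base (★ `isFinite_fst_unit_pow_id` / ★
  `etale_fst_unit_pow_id`, [MumfordFogartyKirwan1994] Lemma 6.12; packaged as `isFinite_and_etale_fst_unit_pow_id_of_algebraRat`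
  over a `ℚ`-algebra).

## References
* [MumfordAV1970] D. Mumford, *Abelian Varieties* (1970), §6 Application 3 (p. 64), §13 (p. 123).
* [GortzWedhorn2023] U. Görtz, T. Wedhorn, *Algebraic Geometry II* (2023), Prop. 27.86 (p. 633), Prop. 27.187, Cor. 27.63.
* [MumfordFogartyKirwan1994] D. Mumford, J. Fogarty, F. Kirwan, *GIT*, 3rd ed. (1994), Ch. 6 §2 Lemma 6.12 (p. 122).
* [EGAIV4] A. Grothendieck, J. Dieudonné, *EGA IV₄* (1967), Cor. 17.4.2 (unramified ⇔ diagonal open).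
-/

set_option autoImplicit false

noncomputable section

-- `TopCat.Presheaf`/`Scheme.Modules` are not reducible (as in ★ `AbelianSchemeKOfLUnramified`).
set_option backward.isDefEq.respectTransparency false

open CategoryTheory CategoryTheory.Limits AlgebraicGeometry MonoidalCategory CartesianMonoidalCategory

open scoped MonObj CategoryTheory.Obj

namespace Literature.AlgebraicGeometry.AbelianSchemes

open Literature.AlgebraicGeometry.Motives Literature.AlgebraicGeometry.Motives.AbelianVariety Literature.AlgebraicGeometry.Limits

/-! ## §1 Sections of unramified `S`-schemes are open immersions -/

section Section

universe u

variable {S : Scheme.{u}}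

/-- **A section of a formally unramified `S`-scheme locally of finite type is an open immersion**: for `Z → S` formally
unramified and locally of finite type, every `S`-morphism `e : S → Z` (a morphism from the unit `𝟙_ (Over S)`) has `e.left` an
open immersion — the diagonal `Z → Z ×_S Z` is an open immersion (Mathlib `isOpenImmersion_diagonal`) and `e` is a base change
of it (Mathlib `MorphismProperty.hasOfPostcompProperty_iff_le_diagonal`, applied to `e ≫ (Z → S) = 𝟙_S`).
[cite: EGAIV4, Cor. 17.4.2] [cite: GortzWedhorn2023, Prop. 27.86 (p. 633) (setting: group schemes unramified over the base)] -/
theorem isOpenImmersion_left_of_section {Z : Over S} [FormallyUnramified Z.hom] [LocallyOfFiniteType Z.hom]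
    (e : 𝟙_ (Over S) ⟶ Z) : IsOpenImmersion e.left := by
  have hQ : MorphismProperty.HasOfPostcompProperty @IsOpenImmersion
      (@LocallyOfFiniteType ⊓ @FormallyUnramified : MorphismProperty Scheme) := by
    rw [MorphismProperty.hasOfPostcompProperty_iff_le_diagonal]
    rintro X Y f ⟨hft, hfu⟩
    haveI : LocallyOfFiniteType f := hft
    haveI : FormallyUnramified f := hfu
    exact inferInstanceAs (IsOpenImmersion (pullback.diagonal f))
  have hcomp : IsOpenImmersion (e.left ≫ Z.hom) := by
    rw [Over.w e, Over.tensorUnit_hom]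
    exact IsOpenImmersion.of_isIso (𝟙 S)
  exact MorphismProperty.of_postcomp (W := @IsOpenImmersion)
    (W' := (@LocallyOfFiniteType ⊓ @FormallyUnramified : MorphismProperty Scheme)) e.left Z.hom
    ⟨‹LocallyOfFiniteType Z.hom›, ‹FormallyUnramified Z.hom›⟩ hcomp

end Section

namespace AbelianSchemeOver

variable {R : Type} [CommRing R] (A : AbelianSchemeOver (Spec (.of R)))

variable {Z : Over (Spec (.of R))} (i : Z ⟶ A.X) [IsClosedImmersion i.left] [IsFinite Z.hom]
  (he : ∃ e : 𝟙_ (Over (Spec (.of R))) ⟶ Z, e ≫ i = 1)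
  (hm : ∃ m : Z ⊗ Z ⟶ Z, m ≫ i = (fst Z Z ≫ i) * (snd Z Z ≫ i))
  (hn : ∃ n : Z ⟶ Z, n ≫ i = i⁻¹)

/-! ## §2 Powers of `i` factor through `Z`; on a fibre the factorisation of `i ^ (order)` is the unit -/

omit [IsClosedImmersion i.left] [IsFinite Z.hom] in
include he hm in
/-- **The powers `i ^ m` factor through `Z`** (`Z` is stable under the unit and the group law).
[cite: GortzWedhorn2023, (27.1.1) (subgroup functors represented by closed subschemes)] -/
theorem exists_hom_comp_eq_pow (m : ℕ) : ∃ v : Z ⟶ Z, v ≫ i = i ^ m := by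
  obtain ⟨e, he⟩ := he
  obtain ⟨μZ, hμ⟩ := hm
  induction m with
  | zero => exact ⟨toUnit Z ≫ e, by rw [Category.assoc, he, MonObj.comp_one, pow_zero]⟩
  | succ m ih =>
    obtain ⟨v, hv⟩ := ih
    refine ⟨lift v (𝟙 Z) ≫ μZ, ?_⟩
    rw [Category.assoc, hμ, MonObj.comp_mul, ← Category.assoc, lift_fst, ← Category.assoc, lift_snd,
      Category.id_comp, hv, pow_succ]

omit [IsFinite Z.hom] in
/-- `i` is a monomorphism of `Over (Spec R)` (a closed immersion). [cite: GortzWedhorn2023, (27.1.1)] -/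
theorem mono_of_isClosedImmersion_left : Mono i :=
  Over.mono_of_mono_left i

omit [IsClosedImmersion i.left] [IsFinite Z.hom] in
/-- If `v ≫ i = i ^ m` and `e ≫ i = 1` then `e ≫ v ≫ i = 1`: the factorisations fix the unit. [cite: GortzWedhorn2023, (27.1.1)] -/
theorem unit_comp_fac_comp (e : 𝟙_ (Over (Spec (.of R))) ⟶ Z) (he' : e ≫ i = 1) {m : ℕ} (v : Z ⟶ Z)
    (hv : v ≫ i = i ^ m) : e ≫ v ≫ i = e ≫ i := by
  rw [hv, MonObj.comp_pow, he', one_pow]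

omit [IsClosedImmersion i.left] [IsFinite Z.hom] in
/-- Composing factorisations of `i ^ m` and `i ^ k` gives a factorisation of `i ^ (m * k)`. [cite: GortzWedhorn2023, (27.1.1)] -/
theorem fac_comp_fac_comp {m k : ℕ} (v w : Z ⟶ Z) (hv : v ≫ i = i ^ m) (hw : w ≫ i = i ^ k) :
    (v ≫ w) ≫ i = i ^ (m * k) := by
  rw [Category.assoc, hw, MonObj.comp_pow, hv, ← pow_mul]

/-- **On the fibre at a field-valued point, the factorisation of `i ^ n` through `Z` is the unit when `n` is the ORDER of
the fibre** `Z_t ⊆ A_t` (★ `finiteSubgroupSubschemeFibre`): DELIGNE's theorem ★ `FiniteSubgroupSubscheme.emb_pow_order`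
(`Z_t` is killed by its order) and `Z_t ↪ A_t` mono. [cite: GortzWedhorn2023, Prop. 27.86 (p. 633)] -/
theorem pullback_map_eq_of_comp_eq_pow_order {K : Type} [Field K] (t : Spec (.of K) ⟶ Spec (.of R))
    (e : 𝟙_ (Over (Spec (.of R))) ⟶ Z) (he' : e ≫ i = 1) (v : Z ⟶ Z)
    (hv : v ≫ i = i ^ (A.finiteSubgroupSubschemeFibre i he hm hn t).order) :
    (Over.pullback t).map v = (Over.pullback t).map (toUnit Z ≫ e) := by
  haveI := (A.finiteSubgroupSubschemeFibre i he hm hn t).mono_emb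
  rw [← cancel_mono (A.finiteSubgroupSubschemeFibre i he hm hn t).emb]
  change (Over.pullback t).map v ≫ (Over.pullback t).map i =
    (Over.pullback t).map (toUnit Z ≫ e) ≫ (Over.pullback t).map i
  rw [← Functor.map_comp, hv, ← Functor.map_comp, Category.assoc, he', MonObj.comp_one, Functor.map_one,
    ← (Over.pullback t).homMonoidHom_apply, map_pow, (Over.pullback t).homMonoidHom_apply]
  exact (A.finiteSubgroupSubschemeFibre i he hm hn t).emb_pow_order

/-- **Every point of `Z` is moved to the unit section by the factorisation of `i ^ n`, `n` the order of its fibre**: for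
`z ∈ Z` over `s ∈ Spec R` and `v ≫ i = i ^ n` with `n` the order of `Z_{κ(s)} ⊆ A_{κ(s)}`, `v z` lies in the image of the unit
`e : Spec R → Z` (read on the fibre `Z ×_R Spec κ(s) → Z`, which hits `z`: Mathlib `Scheme.Pullback.range_fst`).
[cite: GortzWedhorn2023, Prop. 27.86 (p. 633)] -/
theorem fac_apply_mem_range_unit (e : 𝟙_ (Over (Spec (.of R))) ⟶ Z) (he' : e ≫ i = 1) (z : Z.left) (v : Z ⟶ Z)
    (hv : v ≫ i = i ^ (A.finiteSubgroupSubschemeFibre i he hm hn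
      ((Spec (.of R)).fromSpecResidueField (Z.hom.base z))).order) :
    v.left.base z ∈ Set.range e.left.base := by
  set t := (Spec (.of R)).fromSpecResidueField (Z.hom.base z) with ht
  -- `z` lies in the image of the fibre `Z ×_R Spec κ(s) → Z`
  have hz : z ∈ Set.range (pullback.fst Z.hom t).base := by
    rw [Scheme.Pullback.range_fst]
    exact ⟨IsLocalRing.closedPoint _, by rw [ht, Scheme.fromSpecResidueField_apply]⟩
  obtain ⟨z', hz'⟩ := hz
  have key := congrArg (fun w => (w.left ≫ pullback.fst Z.hom t).base z')
    (A.pullback_map_eq_of_comp_eq_pow_order i he hm hn t e he' v hv)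
  simp only [pullback_map_left_comp_fst, Scheme.Hom.comp_base, Over.comp_left, Over.toUnit_left] at key
  rw [← hz']
  exact ⟨_, key.symm⟩

/-! ## §3 (T3) `i ^ n = 1` -/

/-- **(T3) A FINITE UNRAMIFIED CLOSED SUBGROUP SUBSCHEME OF AN ABELIAN SCHEME IS KILLED BY AN INTEGER**: if `Z → Spec R` is
formally unramified (e.g. `R` a `ℚ`-algebra, ★ `formallyUnramified_hom_of_subgroup`), then `i ^ n = 1` in `A(Z)` for some
`n ≥ 1`.  See the module docstring for the proof (open unit section, Deligne on the fibres, quasi-compactness).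
[cite: MumfordAV1970, §13 (p. 123)] [cite: GortzWedhorn2023, Prop. 27.86 (p. 633)] [cite: EGAIV4, Cor. 17.4.2] -/
theorem exists_pow_eq_one_of_formallyUnramified (he : ∃ e : 𝟙_ (Over (Spec (.of R))) ⟶ Z, e ≫ i = 1)
    (hm : ∃ m : Z ⊗ Z ⟶ Z, m ≫ i = (fst Z Z ≫ i) * (snd Z Z ≫ i)) (hn : ∃ n : Z ⟶ Z, n ≫ i = i⁻¹)
    [FormallyUnramified Z.hom] : ∃ n : ℕ, 0 < n ∧ i ^ n = 1 := by
  classical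
  obtain ⟨e, he'⟩ := he
  haveI : Mono i := A.mono_of_isClosedImmersion_left i
  haveI : IsOpenImmersion e.left := isOpenImmersion_left_of_section e
  -- the factorisations `v m` of `i ^ m`
  choose v hv using A.exists_hom_comp_eq_pow i ⟨e, he'⟩ hm
  -- the order of the fibre through a point
  let ord : Z.left → ℕ := fun z =>
    (A.finiteSubgroupSubschemeFibre i ⟨e, he'⟩ hm hn ((Spec (.of R)).fromSpecResidueField (Z.hom.base z))).order
  have hord : ∀ z, 0 < ord z := fun z => FiniteSubgroupSubscheme.order_pos _
  -- the open sets `W m = (v m)⁻¹(im e)` cover `Z`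
  let W : ℕ → Set Z.left := fun m => (v m).left.base ⁻¹' Set.range e.left.base
  have hWo : ∀ m, IsOpen (W m) := fun m =>
    (IsOpenImmersion.isOpen_range e.left).preimage (v m).left.continuous
  have hcov : (Set.univ : Set Z.left) ⊆ ⋃ m ∈ {m : ℕ | 0 < m}, W m := by
    intro z _
    refine Set.mem_biUnion (hord z) ?_
    exact A.fac_apply_mem_range_unit i ⟨e, he'⟩ hm hn e he' z (v (ord z)) (hv (ord z))
  -- `Z` is quasi-compact (finite over the affine base)
  haveI : IsAffine Z.left := isAffine_of_isAffineHom Z.hom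
  obtain ⟨s, hsb, hfin, hsub⟩ := isCompact_univ.elim_finite_subcover_image (fun m _ => hWo m) hcov
  -- `n :=` the product of the chosen indices
  refine ⟨∏ m ∈ hfin.toFinset, m, Finset.prod_pos fun m hm' => hsb (hfin.mem_toFinset.mp hm'), ?_⟩
  set n := ∏ m ∈ hfin.toFinset, m with hn'
  -- every point is moved into the unit section by `v n`
  have hrange : Set.range (v n).left.base ⊆ Set.range e.left.base := by
    rintro _ ⟨z, rfl⟩
    obtain ⟨m, hm', hzm⟩ := Set.mem_iUnion₂.mp (hsub (Set.mem_univ z))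
    obtain ⟨k, hk⟩ : m ∣ n := Finset.dvd_prod_of_mem _ (hfin.mem_toFinset.mpr hm')
    have hvn : v n = v m ≫ v k := by
      rw [← cancel_mono i, A.fac_comp_fac_comp i (v m) (v k) (hv m) (hv k), ← hk, hv n]
    obtain ⟨x, hx⟩ := hzm
    have hek : e ≫ v k = e := by
      rw [← cancel_mono i, Category.assoc, A.unit_comp_fac_comp i e he' (v k) (hv k)]
    refine ⟨x, ?_⟩
    have hcomp : (e ≫ v k).left.base x = (v k).left.base (e.left.base x) := by
      rw [Over.comp_left, Scheme.Hom.comp_base, TopCat.comp_app]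
    rw [hvn, Over.comp_left, Scheme.Hom.comp_base, TopCat.comp_app, ← hx, ← hcomp, hek]
  -- so `v n` factors through the open immersion `e`, i.e. `v n = (Z → Spec R) ≫ e`
  have h1 := IsOpenImmersion.lift_fac e.left (v n).left hrange
  have hw : IsOpenImmersion.lift e.left (v n).left hrange ≫ (𝟙_ (Over (Spec (.of R)))).hom = Z.hom := by
    rw [← Over.w e, ← Category.assoc, h1, Over.w (v n)]
  have hwu : Over.homMk (IsOpenImmersion.lift e.left (v n).left hrange) hw = toUnit Z := toUnit_unique _ _
  have hvn : v n = toUnit Z ≫ e := by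
    rw [← hwu]
    refine Over.OverMorphism.ext ?_
    rw [Over.comp_left]
    exact h1.symm
  rw [← hv n, hvn, Category.assoc, he', MonObj.comp_one]

/-! ## §4 (T4) `Z ⊆ A[n]`, a closed subscheme of a finite étale `Spec R`-scheme -/

omit [IsClosedImmersion i.left] [IsFinite Z.hom] in
/-- `i ^ n = 1` on underlying schemes: `i ≫ [n]_A = (Z → Spec R) ≫ e_A`. [cite: MumfordAV1970, §13 (p. 123)] -/
theorem left_comp_pow_id_left_eq {n : ℕ} (hin : i ^ n = 1) :
    i.left ≫ ((((𝟙 A.X : A.X ⟶ A.X) ^ n) : A.X ⟶ A.X).left) = Z.hom ≫ (η[A.X] : 𝟙_ _ ⟶ A.X).left := by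
  have h : i ≫ ((𝟙 A.X : A.X ⟶ A.X) ^ n) = toUnit Z ≫ η[A.X] := by
    rw [MonObj.comp_pow, Category.comp_id, hin, Hom.one_def]
  have h' := congrArg (fun φ => φ.left) h
  simp only [Over.comp_left, Over.toUnit_left] at h'
  exact h'

omit [IsFinite Z.hom] in
/-- **(T4) `Z ↪ A[n]` is a closed immersion**: the factorisation `j = (Z → Spec R, i) : Z → A[n] = Spec R ×_{e, A, [n]} A` of
`i` through the `n`-torsion (given `i ^ n = 1`) is a closed immersion, since `j ≫ (A[n] → A) = i` is one and `A[n] → A` (a base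
change of the unit section) is separated. [cite: MumfordAV1970, §13 (p. 123)] [cite: MumfordFogartyKirwan1994, Ch. 6 §2 Lemma 6.12 (p. 122)] -/
theorem isClosedImmersion_pullbackLift_unit_pow_id {n : ℕ} (hin : i ^ n = 1) :
    IsClosedImmersion (pullback.lift Z.hom i.left (A.left_comp_pow_id_left_eq i hin).symm :
      Z.left ⟶ pullback (η[A.X] : 𝟙_ _ ⟶ A.X).left ((((𝟙 A.X : A.X ⟶ A.X) ^ n) : A.X ⟶ A.X).left)) := by
  have h : IsClosedImmersion (pullback.lift Z.hom i.left (A.left_comp_pow_id_left_eq i hin).symm ≫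
      pullback.snd (η[A.X] : 𝟙_ _ ⟶ A.X).left ((((𝟙 A.X : A.X ⟶ A.X) ^ n) : A.X ⟶ A.X).left)) := by
    rw [pullback.lift_snd]
    infer_instance
  exact MorphismProperty.of_postcomp (W := @IsClosedImmersion) (W' := @IsSeparated) _
    (pullback.snd _ _) inferInstance h

omit [IsClosedImmersion i.left] [IsFinite Z.hom] in
/-- `j ≫ (A[n] → Spec R) = (Z → Spec R)`. [cite: MumfordAV1970, §13 (p. 123)] -/
theorem pullbackLift_unit_pow_id_fst {n : ℕ} (hin : i ^ n = 1) :
    pullback.lift Z.hom i.left (A.left_comp_pow_id_left_eq i hin).symm ≫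
      pullback.fst (η[A.X] : 𝟙_ _ ⟶ A.X).left ((((𝟙 A.X : A.X ⟶ A.X) ^ n) : A.X ⟶ A.X).left) = Z.hom :=
  pullback.lift_fst _ _ _

omit [IsClosedImmersion i.left] [IsFinite Z.hom] in
/-- `j ≫ (A[n] → A) = i`. [cite: MumfordAV1970, §13 (p. 123)] -/
theorem pullbackLift_unit_pow_id_snd {n : ℕ} (hin : i ^ n = 1) :
    pullback.lift Z.hom i.left (A.left_comp_pow_id_left_eq i hin).symm ≫
      pullback.snd (η[A.X] : 𝟙_ _ ⟶ A.X).left ((((𝟙 A.X : A.X ⟶ A.X) ^ n) : A.X ⟶ A.X).left) = i.left :=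
  pullback.lift_snd _ _ _

/-- **`A[n] → Spec R` is FINITE and ÉTALE over a `ℚ`-algebra for `n ≥ 1`** (★ `isFinite_fst_unit_pow_id`, ★ `etale_fst_unit_pow_id`;
`n ≠ 0` in every residue field of `Spec R` because the residue fields are `ℚ`-algebras).
[cite: MumfordFogartyKirwan1994, Ch. 6 §2 Lemma 6.12 (p. 122)] [cite: GortzWedhorn2023, Prop. 27.187] -/
theorem isFinite_and_etale_fst_unit_pow_id_of_algebraRat [Algebra ℚ R] {n : ℕ} (hn0 : 0 < n) :
    IsFinite (pullback.fst (η[A.X] : 𝟙_ _ ⟶ A.X).left ((((𝟙 A.X : A.X ⟶ A.X) ^ n) : A.X ⟶ A.X).left)) ∧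
      Etale (pullback.fst (η[A.X] : 𝟙_ _ ⟶ A.X).left ((((𝟙 A.X : A.X ⟶ A.X) ^ n) : A.X ⟶ A.X).left)) :=
  A.isFinite_and_etale_fst_unit_pow_id_of_charZero
    (Spec.map (CommRingCat.ofHom (algebraMap ℚ R))) (Nat.pos_iff_ne_zero.mp hn0)

end AbelianSchemeOver

end Literature.AlgebraicGeometry.AbelianSchemes

end
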